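import Summits.ValiantsHypothesis.ValiantsHypothesis.Theorems.KPlusLogSqLawTropicalSymmetricOrbitThreeFourV2C

/-!
# Route «KPlusLogSqLaw» — the symmetric `(3,4)` tropical row in the ORBIT model — abstract exclusion lemmas, part 7:
# the five-class core `{0,1,3}, {0,2,3}, {1,1,3}, {1,2,2}, {2,2,2}` (`core5`)

HONEST FRAMING.  Helper file (seat val-sym-lift-p2 (g6), cell `pub-symmetroid`, 2026-08-27; `--supports` the `WeakLifting` item
stmt-ValiantsHypothesis-19561 as a helper, no closure claim).  A SMALL-FORMAT statement in the transpose-ORBIT carrier model, far inside the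
known regime of the cruxes; port blueprint `HOME/val-sym-lift-p2/g6/LEMMA-Z-liftp2g6.md` §6–§7.  Nothing here is about `TropicalB` /
`WeakLifting` in their windows, Conjecture B, DoorA34 = `PosRootLawAt 3 4 18` (OPEN, never asserted), `MatrixDescartes`
(stmt-ValiantsHypothesis-18050) or VP ≠ VNP; `TSymOrb34Le17` / `TSymOrb34Le16` stay targets here (NOT asserted).

THIS FILE.  Two-term killers `CC_023_113` (two pair carriers), `TC_023_113` (a transposition `{1,1,3}` against a pair carrier `{0,2,3}`),
`D023_C222` (identity `{0,2,3}` against a pair carrier `{2,2,2}`), the four-term `K11` (`{0,1,3} = D`, `{0,2,3} = D`, `{1,2,2} = T`,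
`{2,2,2} = T`: both transpositions fix the `2`-column of `{0,2,3}`), and the assembled **`core5`**: under the orbit-chain hypotheses the five
multisets `{0,1,3}, {0,2,3}, {1,1,3}, {1,2,2}, {2,2,2}` are never all carried — the exclusion core used when `{1,1,2}` is the missed class
(blueprint §5: third of the five cores for `TSymOrb34Le17`; its mirror handles a missed `{1,2,2}`).
[cell statement R1732; folklore-level exchange arguments, no citation exists]
-/

set_option linter.dupNamespace false
set_option autoImplicit false

namespace Summit.ValiantsHypothesis.ValiantsHypothesis.Theorems.KPlusLogSqLaw

open Summit.ValiantsHypothesis.ValiantsHypothesis.Theorems.MatrixDescartes.Negative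
open Summit.ValiantsHypothesis.ValiantsHypothesis.Theorems.LacunarySymmetroidMatrixDescartes
open Summit.ValiantsHypothesis.ValiantsHypothesis.Theorems.LacunarySymmetroidMatrixDescartes.TropicalCensus
open Finset

namespace SymmetricOrbitThreeFour

open SymmetricThreeFour SymmetricThreeFourSeventeen SymmetricThreeFourSixteen SymmetricThreeFourFifteen

/-- class counts of the pattern vector `(1,1,3)`. -/
theorem cnt113 : ∀ l : Fin 4, (univ.filter fun i : Fin 3 => (![1, 1, 3] : Fin 3 → Fin 4) i = l).card = (![0, 2, 0, 1] : Fin 4 → ℕ) l := by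
  decide

/-- **`CC_023_113`**: `{0,2,3}` and `{1,1,3}` are not both carried by pair carriers (matched letters: the later one would need two letters
`≥ 2`, resp. the earlier `{0,2,3}` would put its `0` under a letter of `{1,1,3}`). [CC_dominated] -/
theorem CC_023_113 {n : ℕ} (r : Fin (n + 1) → Equiv.Perm (Fin 3) × (Fin 3 → Fin 4))
    (hM : ∀ a b : Fin (n + 1), a < b → ∀ l₁ l₂ : Fin 3,
      ((r a).1 l₁ = (r b).1 l₂ ∧ l₁ = l₂) ∨ ((r a).1 l₁ = l₂ ∧ (r b).1 l₂ = l₁) → (r a).2 l₁ ≤ (r b).2 l₂)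
    (b f : Fin (n + 1)) (hb : ∀ i, (r b).1 i ≠ i) (hf : ∀ i, (r f).1 i ≠ i)
    (hbC : TropicalCensus.classSym (r b) = TropicalCensus.classSym ((1 : Equiv.Perm (Fin 3)), (![0, 2, 3] : Fin 3 → Fin 4)))
    (hfC : TropicalCensus.classSym (r f) = TropicalCensus.classSym ((1 : Equiv.Perm (Fin 3)), (![1, 1, 3] : Fin 3 → Fin 4))) : False := by
  have cb : ∀ l, (univ.filter fun x => (r b).2 x = l).card = (![1, 0, 1, 1] : Fin 4 → ℕ) l :=
    fun l => (card_filter_eq_of_classSym_eq hbC l).trans (cnt023 l)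
  have cf : ∀ l, (univ.filter fun x => (r f).2 x = l).card = (![0, 2, 0, 1] : Fin 4 → ℕ) l :=
    fun l => (card_filter_eq_of_classSym_eq hfC l).trans (cnt113 l)
  have hbf : b ≠ f := by intro h; have := cb 0; rw [h, cf 0] at this; exact absurd this (by decide)
  have f0 : ∀ l, (r f).2 l ≠ 0 := ne_of_card_zero _ 0 (by rw [cf 0]; rfl)
  have f2 : ∀ l, (r f).2 l ≠ 2 := ne_of_card_zero _ 2 (by rw [cf 2]; rfl)
  obtain ⟨β0, hβ0⟩ := exists_of_card_pos ((r b).2) 0 (by rw [cb 0]; decide)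
  obtain ⟨β2, hβ2⟩ := exists_of_card_pos ((r b).2) 2 (by rw [cb 2]; decide)
  obtain ⟨β3, hβ3⟩ := exists_of_card_pos ((r b).2) 3 (by rw [cb 3]; decide)
  have hβ23 : β2 ≠ β3 := by rintro rfl; rw [hβ2] at hβ3; exact absurd hβ3 (by decide)
  have f13 : ∀ l, 2 ≤ (r f).2 l → (r f).2 l = 3 := fun l hl => f4_d _ hl (f2 l)
  rcases lt_or_gt_of_ne hbf with h | h
  · obtain ⟨φ, hφ⟩ := CC_dominated r hM b f h hb hf
    have h2 := hφ β2; rw [hβ2] at h2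
    have h3 := hφ β3; rw [hβ3] at h3
    have e2 : (r f).2 (φ β2) = 3 := f13 _ h2
    have e3 : (r f).2 (φ β3) = 3 := f13 _ (le_trans (by decide) h3)
    have hne : φ β2 ≠ φ β3 := fun hh => hβ23 (φ.injective hh)
    have := two_le_card_filter (r f) hne (e2.trans e3.symm)
    rw [e3, cf 3] at this; exact absurd this (by decide)
  · obtain ⟨φ, hφ⟩ := CC_dominated r hM f b h hf hb
    have h0 := hφ (φ.symm β0)
    rw [Equiv.apply_symm_apply, hβ0] at h0
    exact f0 _ (le_antisymm h0 (Fin.zero_le _))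

/-- **`TC_023_113`**: `{1,1,3}` on a transposition term (pair rank `1`, fixed rank `3`) and `{0,2,3}` on a pair carrier cannot coexist.
[TC_facts: the cross-pair inequality reads `g 3 + g 1 < g 0 + g 3` or `g 2 + g 3 < g 3 + g 1`] -/
theorem TC_023_113 {n : ℕ} (r : Fin (n + 1) → Equiv.Perm (Fin 3) × (Fin 3 → Fin 4)) (g : Fin 4 → ℕ) (hmono : Monotone g)
    (hM : ∀ a b : Fin (n + 1), a < b → ∀ l₁ l₂ : Fin 3,
      ((r a).1 l₁ = (r b).1 l₂ ∧ l₁ = l₂) ∨ ((r a).1 l₁ = l₂ ∧ (r b).1 l₂ = l₁) → (r a).2 l₁ ≤ (r b).2 l₂)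
    (hR2 : ∀ a b : Fin (n + 1), a < b → ∀ i j k : Fin 3, i ≠ j → k ≠ i → k ≠ j → (r a).1 = Equiv.swap i j →
      (r a).2 i = (r a).2 j → (r b).1 i = j → (r b).1 j = k → (r b).1 k = i →
      g ((r a).2 k) + g ((r a).2 i) < g ((r b).2 j) + g ((r b).2 k))
    (hR2' : ∀ a b : Fin (n + 1), a < b → ∀ i j k : Fin 3, i ≠ j → k ≠ i → k ≠ j → (r a).1 i = j → (r a).1 j = k → (r a).1 k = i →
      (r b).1 = Equiv.swap i j → (r b).2 i = (r b).2 j → g ((r a).2 j) + g ((r a).2 k) < g ((r b).2 k) + g ((r b).2 i))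
    (b f : Fin (n + 1)) (hb : ∀ i, (r b).1 i ≠ i)
    (hbC : TropicalCensus.classSym (r b) = TropicalCensus.classSym ((1 : Equiv.Perm (Fin 3)), (![0, 2, 3] : Fin 3 → Fin 4)))
    (hfC : TropicalCensus.classSym (r f) = TropicalCensus.classSym ((1 : Equiv.Perm (Fin 3)), (![1, 1, 3] : Fin 3 → Fin 4)))
    {i j : Fin 3} (hij : i < j) (hf1 : (r f).1 = Equiv.swap i j) (hff : (r f).2 i = (r f).2 j) : False := by
  have cb : ∀ l, (univ.filter fun x => (r b).2 x = l).card = (![1, 0, 1, 1] : Fin 4 → ℕ) l :=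
    fun l => (card_filter_eq_of_classSym_eq hbC l).trans (cnt023 l)
  have cf : ∀ l, (univ.filter fun x => (r f).2 x = l).card = (![0, 2, 0, 1] : Fin 4 → ℕ) l :=
    fun l => (card_filter_eq_of_classSym_eq hfC l).trans (cnt113 l)
  have hbf : b ≠ f := by intro h; have := cb 0; rw [h, cf 0] at this; exact absurd this (by decide)
  have wb1 : ∀ l, (r b).2 l ≠ 1 := ne_of_card_zero _ 1 (by rw [cb 1]; rfl)
  have g01 : g 0 ≤ g 1 := hmono (by decide)
  have g12 : g 1 ≤ g 2 := hmono (by decide)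
  have gle3 : ∀ y : Fin 4, g y ≤ g 3 := fun y => hmono (Fin.le_last _)
  have hij' : i ≠ j := ne_of_lt hij
  obtain ⟨kf, hkfi, hkfj⟩ := exists_third i j
  have f4_q : ∀ x : Fin 4, x ≠ 0 → x ≠ 2 → x = 3 ∨ x = 1 := by decide
  obtain ⟨hfi, hfk⟩ := swap_letters r f hij' hkfi hkfj hff 3 1 (by rw [cf 3]; rfl) (by rw [cf 1]; rfl)
    (fun l => f4_q _ (ne_of_card_zero _ 0 (by rw [cf 0]; rfl) l) (ne_of_card_zero _ 2 (by rw [cf 2]; rfl) l))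
  obtain ⟨l, m, hlm, hσ, hfb, hbf'⟩ := TC_facts r g hM hR2 hR2' f b hij' hkfi hkfj hf1 hff hb
  have hlm' : l ≠ m ∧ kf ≠ l ∧ kf ≠ m := by
    rcases hlm with ⟨rfl, rfl⟩ | ⟨rfl, rfl⟩
    · exact ⟨hij', hkfi, hkfj⟩
    · exact ⟨hij'.symm, hkfj, hkfi⟩
  obtain ⟨hlm1, hkl, hkm⟩ := hlm'
  obtain ⟨β0, hβ0⟩ := exists_of_card_pos ((r b).2) 0 (by rw [cb 0]; decide)
  rcases lt_or_gt_of_ne hbf with h | h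
  · -- `C` before `T`: the column `l` of `w` reads `0`; the other two letters are `2, 3`
    obtain ⟨hle, hC⟩ := hbf' h
    rw [hfi, hfk] at hC
    rw [hfi] at hle
    have hl0 : (r b).2 l = 0 := f4_f _ hle (wb1 l)
    have hm0 : (r b).2 m ≠ 0 := ne_of_card_one _ 0 (by rw [cb 0]; rfl) hl0 hlm1.symm
    have hk0 : (r b).2 kf ≠ 0 := ne_of_card_one _ 0 (by rw [cb 0]; rfl) hl0 hkl
    rcases f4_h _ (f4_b _ hm0) (wb1 m) with hm | hm <;> rcases f4_h _ (f4_b _ hk0) (wb1 kf) with hk | hk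
    · have := two_le_card_filter (r b) hkm (hk.trans hm.symm); rw [hm, cb 2] at this; exact absurd this (by decide)
    · rw [hm, hk] at hC; omega
    · rw [hm, hk] at hC; omega
    · have := two_le_card_filter (r b) hkm (hk.trans hm.symm); rw [hm, cb 3] at this; exact absurd this (by decide)
  · -- `T` before `C`: the column `l` of `w` is not `0`, so `0` sits at `m` or at the third column
    obtain ⟨hle, hC⟩ := hfb h
    rw [hfi, hfk] at hC
    rw [hfi] at hle
    have hl0 : (r b).2 l ≠ 0 := fun hh => by rw [hh] at hle; exact absurd hle (by decide)
    have hβl : β0 ≠ l := fun hh => hl0 (hh ▸ hβ0)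
    rcases eq_or_eq_of_ne_third m kf l β0 hkm.symm hlm1.symm hkl hβl with hh | hh
    · rw [← hh, hβ0] at hC; have := gle3 ((r b).2 kf); omega
    · rw [← hh, hβ0] at hC; have := gle3 ((r b).2 m); omega

/-- **`D023_C222`**: `{0,2,3}` on an identity term and `{2,2,2}` on a pair carrier cannot coexist: the cancellation at the pair of the
carrier through the `2`- and `3`-columns (resp. the `0`- and `2`-columns) of `{0,2,3}` fails. [hR3 / hR3'] -/
theorem D023_C222 {n : ℕ} (r : Fin (n + 1) → Equiv.Perm (Fin 3) × (Fin 3 → Fin 4)) (g : Fin 4 → ℕ) (hmono : Monotone g)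
    (hR3 : ∀ a b : Fin (n + 1), a < b → (r a).1 = 1 → ∀ i j k : Fin 3, i ≠ j → k ≠ i → k ≠ j →
      (r b).1 i = j → (r b).1 j = k → (r b).1 k = i → g ((r a).2 i) + g ((r a).2 j) < 2 * g ((r b).2 i))
    (hR3' : ∀ a b : Fin (n + 1), a < b → (r b).1 = 1 → ∀ i j k : Fin 3, i ≠ j → k ≠ i → k ≠ j →
      (r a).1 i = j → (r a).1 j = k → (r a).1 k = i → 2 * g ((r a).2 i) < g ((r b).2 i) + g ((r b).2 j))
    (b q : Fin (n + 1)) (hb1 : (r b).1 = 1) (hq : ∀ i, (r q).1 i ≠ i)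
    (hbC : TropicalCensus.classSym (r b) = TropicalCensus.classSym ((1 : Equiv.Perm (Fin 3)), (![0, 2, 3] : Fin 3 → Fin 4)))
    (hqC : TropicalCensus.classSym (r q) = TropicalCensus.classSym ((1 : Equiv.Perm (Fin 3)), (![2, 2, 2] : Fin 3 → Fin 4))) : False := by
  have cb : ∀ l, (univ.filter fun x => (r b).2 x = l).card = (![1, 0, 1, 1] : Fin 4 → ℕ) l :=
    fun l => (card_filter_eq_of_classSym_eq hbC l).trans (cnt023 l)
  have cq : ∀ l, (univ.filter fun x => (r q).2 x = l).card = (![0, 0, 3, 0] : Fin 4 → ℕ) l :=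
    fun l => (card_filter_eq_of_classSym_eq hqC l).trans (cnt222 l)
  have hbq : b ≠ q := by intro h; rw [h] at hb1; exact fpf_ne_one hq hb1
  have q2 : ∀ l, (r q).2 l = 2 := fun l => f4_j _ (ne_of_card_zero _ 0 (by rw [cq 0]; rfl) l)
    (ne_of_card_zero _ 1 (by rw [cq 1]; rfl) l) (ne_of_card_zero _ 3 (by rw [cq 3]; rfl) l)
  have g02 : g 0 ≤ g 2 := hmono (by decide)
  have g23 : g 2 ≤ g 3 := hmono (by decide)
  obtain ⟨β0, hβ0⟩ := exists_of_card_pos ((r b).2) 0 (by rw [cb 0]; decide)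
  obtain ⟨β2, hβ2⟩ := exists_of_card_pos ((r b).2) 2 (by rw [cb 2]; decide)
  obtain ⟨β3, hβ3⟩ := exists_of_card_pos ((r b).2) 3 (by rw [cb 3]; decide)
  have h02 : β0 ≠ β2 := by rintro rfl; rw [hβ0] at hβ2; exact absurd hβ2 (by decide)
  have h03 : β0 ≠ β3 := by rintro rfl; rw [hβ0] at hβ3; exact absurd hβ3 (by decide)
  have h23 : β2 ≠ β3 := by rintro rfl; rw [hβ2] at hβ3; exact absurd hβ3 (by decide)
  rcases lt_or_gt_of_ne hbq with h | h
  · -- `D` before `C`: the pair through the `2`- and `3`-columns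
    rcases fpf_orient (r q).1 hq β2 β3 h23 with hor | hor
    · obtain ⟨h2', h3'⟩ := fpf_next (r q).1 hq β2 β3 β0 h23 h02 h03 hor
      have hC := hR3 b q h hb1 β2 β3 β0 h23 h02 h03 hor h2' h3'
      rw [hβ2, hβ3, q2] at hC; omega
    · obtain ⟨h2', h3'⟩ := fpf_next (r q).1 hq β3 β2 β0 h23.symm h03 h02 hor
      have hC := hR3 b q h hb1 β3 β2 β0 h23.symm h03 h02 hor h2' h3'
      rw [hβ2, hβ3, q2] at hC; omega
  · -- `C` before `D`: the pair through the `0`- and `2`-columns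
    rcases fpf_orient (r q).1 hq β0 β2 h02 with hor | hor
    · obtain ⟨h2', h3'⟩ := fpf_next (r q).1 hq β0 β2 β3 h02 h03.symm h23.symm hor
      have hC := hR3' q b h hb1 β0 β2 β3 h02 h03.symm h23.symm hor h2' h3'
      rw [hβ0, hβ2, q2] at hC; omega
    · obtain ⟨h2', h3'⟩ := fpf_next (r q).1 hq β2 β0 β3 h02.symm h23.symm h03.symm hor
      have hC := hR3' q b h hb1 β2 β0 β3 h02.symm h23.symm h03.symm hor h2' h3'
      rw [hβ0, hβ2, q2] at hC; omega

/-- **`K11`**: `{0,1,3} = D(u)`, `{0,2,3} = D(w)`, `{1,2,2} = T`, `{2,2,2} = T` is impossible: both transpositions precede `D(w)` and fix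
its `2`-column (pair monotonicity `2·g 2 < g 0 + g 3` rules out the other placements), and then `{2,2,2}` can be on neither side of `D(u)`
(`u` reads `1` at that column; after it, `g 0 + g 3 < 2·g 2`). [DD_frame, orbY2, hM, hR1, hR1'] -/
theorem K11 {n : ℕ} (r : Fin (n + 1) → Equiv.Perm (Fin 3) × (Fin 3 → Fin 4)) (g : Fin 4 → ℕ) (hmono : Monotone g)
    (hM : ∀ a b : Fin (n + 1), a < b → ∀ l₁ l₂ : Fin 3,
      ((r a).1 l₁ = (r b).1 l₂ ∧ l₁ = l₂) ∨ ((r a).1 l₁ = l₂ ∧ (r b).1 l₂ = l₁) → (r a).2 l₁ ≤ (r b).2 l₂)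
    (hR1 : ∀ a b : Fin (n + 1), a < b → (r a).1 = 1 → ∀ i j : Fin 3, i ≠ j → (r b).1 = Equiv.swap i j → (r b).2 i = (r b).2 j →
      g ((r a).2 i) + g ((r a).2 j) < 2 * g ((r b).2 i))
    (hR1' : ∀ a b : Fin (n + 1), a < b → (r b).1 = 1 → ∀ i j : Fin 3, i ≠ j → (r a).1 = Equiv.swap i j → (r a).2 i = (r a).2 j →
      2 * g ((r a).2 i) < g ((r b).2 i) + g ((r b).2 j))
    (a b e q : Fin (n + 1)) (ha1 : (r a).1 = 1) (hb1 : (r b).1 = 1)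
    (haC : TropicalCensus.classSym (r a) = TropicalCensus.classSym ((1 : Equiv.Perm (Fin 3)), (![0, 1, 3] : Fin 3 → Fin 4)))
    (hbC : TropicalCensus.classSym (r b) = TropicalCensus.classSym ((1 : Equiv.Perm (Fin 3)), (![0, 2, 3] : Fin 3 → Fin 4)))
    (heC : TropicalCensus.classSym (r e) = TropicalCensus.classSym ((1 : Equiv.Perm (Fin 3)), (![1, 2, 2] : Fin 3 → Fin 4)))
    (hqC : TropicalCensus.classSym (r q) = TropicalCensus.classSym ((1 : Equiv.Perm (Fin 3)), (![2, 2, 2] : Fin 3 → Fin 4)))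
    {ie je : Fin 3} (hije : ie < je) (he1 : (r e).1 = Equiv.swap ie je) (hee : (r e).2 ie = (r e).2 je)
    {iq jq : Fin 3} (hijq : iq < jq) (hq1 : (r q).1 = Equiv.swap iq jq) (hqq : (r q).2 iq = (r q).2 jq) : False := by
  obtain ⟨hab, κ0, κ1, κ3, hκ01, hκ30, hκ31, hu0, hu1, hu3, hw0, hw1, hw3⟩ := DD_frame r hM a b ha1 hb1 haC hbC
  have ca : ∀ l, (univ.filter fun x => (r a).2 x = l).card = (![1, 1, 0, 1] : Fin 4 → ℕ) l :=
    fun l => (card_filter_eq_of_classSym_eq haC l).trans (cnt013 l)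
  have cb : ∀ l, (univ.filter fun x => (r b).2 x = l).card = (![1, 0, 1, 1] : Fin 4 → ℕ) l :=
    fun l => (card_filter_eq_of_classSym_eq hbC l).trans (cnt023 l)
  have ce : ∀ l, (univ.filter fun x => (r e).2 x = l).card = (![0, 1, 2, 0] : Fin 4 → ℕ) l :=
    fun l => (card_filter_eq_of_classSym_eq heC l).trans (cnt122 l)
  have cq : ∀ l, (univ.filter fun x => (r q).2 x = l).card = (![0, 0, 3, 0] : Fin 4 → ℕ) l :=
    fun l => (card_filter_eq_of_classSym_eq hqC l).trans (cnt222 l)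
  have y2 : 2 * g 2 < g 0 + g 3 := orbY2 r g hmono hM hR1 hR1' b e hb1 hbC heC (Or.inr ⟨ie, je, hije, he1, hee⟩)
  have g02 : g 0 ≤ g 2 := hmono (by decide)
  have g23 : g 2 ≤ g 3 := hmono (by decide)
  have wb1 : ∀ l, (r b).2 l ≠ 1 := ne_of_card_zero _ 1 (by rw [cb 1]; rfl)
  have ua2 : ∀ l, (r a).2 l ≠ 2 := ne_of_card_zero _ 2 (by rw [ca 2]; rfl)
  have q2 : ∀ l, (r q).2 l = 2 := fun l => f4_j _ (ne_of_card_zero _ 0 (by rw [cq 0]; rfl) l)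
    (ne_of_card_zero _ 1 (by rw [cq 1]; rfl) l) (ne_of_card_zero _ 3 (by rw [cq 3]; rfl) l)
  have hije' : ie ≠ je := ne_of_lt hije
  have hijq' : iq ≠ jq := ne_of_lt hijq
  obtain ⟨ke, hkei, hkej⟩ := exists_third ie je
  obtain ⟨kq, hkqi, hkqj⟩ := exists_third iq jq
  obtain ⟨hei, hek⟩ := swap_letters r e hije' hkei hkej hee 1 2 (by rw [ce 1]; rfl) (by rw [ce 2]; rfl)
    (letters12 r e (by rw [ce 0]; rfl) (by rw [ce 3]; rfl))
  have hek' : (r e).1 ke = ke := by rw [he1, Equiv.swap_apply_of_ne_of_ne hkei hkej]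
  have hqk' : (r q).1 kq = kq := by rw [hq1, Equiv.swap_apply_of_ne_of_ne hkqi hkqj]
  have hbe : b ≠ e := by intro h; have := cb 0; rw [h, ce 0] at this; exact absurd this (by decide)
  have hbq : b ≠ q := by intro h; have := cb 0; rw [h, cq 0] at this; exact absurd this (by decide)
  have haq : a ≠ q := by intro h; have := ca 0; rw [h, cq 0] at this; exact absurd this (by decide)
  -- the `w`-letters off the `0`-column are `≥ 2`; off the `3`-column `≤ 2`; the pair complementary to `κ1` reads `0, 3`
  have w0u : ∀ x, x ≠ κ0 → (r b).2 x ≠ 0 := fun x hx => ne_of_card_one _ 0 (by rw [cb 0]; rfl) hw0 hx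
  have w3u : ∀ x, x ≠ κ3 → (r b).2 x ≠ 3 := fun x hx => ne_of_card_one _ 3 (by rw [cb 3]; rfl) hw3 hx
  have w2u : ∀ x, x ≠ κ1 → (r b).2 x ≠ 2 := fun x hx => ne_of_card_one _ 2 (by rw [cb 2]; rfl) hw1 hx
  have gw_lo : ∀ x, x ≠ κ0 → g 2 ≤ g ((r b).2 x) := fun x hx => hmono (f4_g _ (w0u x hx) (wb1 x))
  have gw_hi : ∀ x, x ≠ κ3 → g ((r b).2 x) ≤ g 2 := fun x hx => hmono (f4_i _ (w3u x hx))
  have pair03w : ∀ x y : Fin 3, x ≠ y → x ≠ κ1 → y ≠ κ1 → g ((r b).2 x) + g ((r b).2 y) = g 0 + g 3 := by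
    intro x y hxy hx hy
    rcases f4_c _ (wb1 x) (w2u x hx) with hx' | hx' <;> rcases f4_c _ (wb1 y) (w2u y hy) with hy' | hy'
    · have := two_le_card_filter (r b) hxy.symm (hy'.trans hx'.symm); rw [hx', cb 0] at this; exact absurd this (by decide)
    · rw [hx', hy']
    · rw [hx', hy', Nat.add_comm]
    · have := two_le_card_filter (r b) hxy.symm (hy'.trans hx'.symm); rw [hx', cb 3] at this; exact absurd this (by decide)
  have pair03u : ∀ x y : Fin 3, x ≠ y → x ≠ κ1 → y ≠ κ1 → g ((r a).2 x) + g ((r a).2 y) = g 0 + g 3 := by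
    intro x y hxy hx hy
    have u1u : ∀ z, z ≠ κ1 → (r a).2 z ≠ 1 := fun z hz => ne_of_card_one _ 1 (by rw [ca 1]; rfl) hu1 hz
    rcases f4_c _ (u1u x hx) (ua2 x) with hx' | hx' <;> rcases f4_c _ (u1u y hy) (ua2 y) with hy' | hy'
    · have := two_le_card_filter (r a) hxy.symm (hy'.trans hx'.symm); rw [hx', ca 0] at this; exact absurd this (by decide)
    · rw [hx', hy']
    · rw [hx', hy', Nat.add_comm]
    · have := two_le_card_filter (r a) hxy.symm (hy'.trans hx'.symm); rw [hx', ca 3] at this; exact absurd this (by decide)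
  -- a transposition term with pair rank `2` and fixed column `k` precedes `D(w)` and has `k = κ1`
  have key : ∀ (t : Fin (n + 1)) (i j k : Fin 3), i ≠ j → k ≠ i → k ≠ j → b ≠ t → (r t).1 = Equiv.swap i j →
      (r t).2 i = (r t).2 j → (r t).2 i = 2 → (r t).1 k = k → 1 ≤ (r t).2 k → (r t).2 k ≤ 2 → t < b ∧ k = κ1 := by
    intro t i j k hij hki hkj hbt ht1 htt hti htk hk1 hk2
    rcases lt_or_gt_of_ne hbt with h | h
    · exfalso
      have hle := hM b t h k k (Or.inl ⟨by rw [hb1, htk, Equiv.Perm.one_apply], rfl⟩)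
      have hC := hR1 b t h hb1 i j hij ht1 htt
      rw [hti] at hC
      have hk3 : k ≠ κ3 := fun hh => by rw [hh] at hle hk2; rw [hw3] at hle; exact absurd (le_trans hle hk2) (by decide)
      by_cases hk0 : k = κ0
      · have gi := gw_lo i (fun hh => hki (hk0.trans hh.symm))
        have gj := gw_lo j (fun hh => hkj (hk0.trans hh.symm))
        omega
      · have hkk : k = κ1 := by
          rcases eq_or_eq_of_ne_third κ0 κ1 κ3 k hκ01 hκ30.symm hκ31.symm hk3 with hh | hh
          · exact absurd hh hk0
          · exact hh
        have := pair03w i j hij (fun hh => hki (hkk.trans hh.symm)) (fun hh => hkj (hkk.trans hh.symm))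
        omega
    · refine ⟨h, ?_⟩
      have hle := hM t b h k k (Or.inl ⟨by rw [hb1, htk, Equiv.Perm.one_apply], rfl⟩)
      have hC := hR1' t b h hb1 i j hij ht1 htt
      rw [hti] at hC
      have hk0 : k ≠ κ0 := fun hh => by rw [hh] at hle hk1; rw [hw0] at hle; exact absurd (le_trans hk1 hle) (by decide)
      by_contra hk1'
      have hkk : k = κ3 := by
        rcases eq_or_eq_of_ne_third κ0 κ3 κ1 k hκ30.symm hκ01 hκ31 hk1' with hh | hh
        · exact absurd hh hk0
        · exact hh
      have gi := gw_hi i (fun hh => hki (hkk.trans hh.symm))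
      have gj := gw_hi j (fun hh => hkj (hkk.trans hh.symm))
      -- not both letters are `2`
      have hne : ¬ ((r b).2 i = 2 ∧ (r b).2 j = 2) := fun hh => by
        have := two_le_card_filter (r b) hij.symm (hh.2.trans hh.1.symm); rw [hh.1, cb 2] at this; exact absurd this (by decide)
      rcases f4_cases ((r b).2 i) with hi | hi | hi | hi
      · rw [hi] at hC; omega
      · exact wb1 i hi
      · rcases f4_cases ((r b).2 j) with hj | hj | hj | hj
        · rw [hj] at hC; omega
        · exact wb1 j hj
        · exact hne ⟨hi, hj⟩
        · exact w3u j (fun hh => hkj (hkk.trans hh.symm)) hj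
      · exact w3u i (fun hh => hki (hkk.trans hh.symm)) hi
  obtain ⟨-, hke⟩ := key e ie je ke hije' hkei hkej hbe he1 hee hei hek' (by rw [hek]) (by rw [hek]; decide)
  obtain ⟨-, hkq⟩ := key q iq jq kq hijq' hkqi hkqj hbq hq1 hqq (q2 iq) hqk' (by rw [q2]; decide) (by rw [q2])
  -- `{2,2,2}` against `D(u)`: after it, `g 0 + g 3 < 2 g 2`; before it, `2 ≤ u κ1 = 1`
  rcases lt_or_gt_of_ne haq with h | h
  · have hC := hR1 a q h ha1 iq jq hijq' hq1 hqq
    rw [q2, pair03u iq jq hijq' (fun hh => hkqi (hkq.trans hh.symm)) (fun hh => hkqj (hkq.trans hh.symm))] at hC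
    omega
  · have hle := hM q a h kq kq (Or.inl ⟨by rw [ha1, hqk', Equiv.Perm.one_apply], rfl⟩)
    rw [q2, hkq, hu1] at hle
    exact absurd hle (by decide)

/-- **ORBIT FIVE-CLASS CORE (`core5`).**  Under the orbit-chain hypotheses, `{0,1,3}, {0,2,3}, {1,1,3}, {1,2,2}, {2,2,2}` are not all
carried. [typed case tree: C_extreme_D, CC_023_113, TC_023_113, DD_023_low, K2, D023_C222, K11] -/
theorem core5 {n : ℕ} (r : Fin (n + 1) → Equiv.Perm (Fin 3) × (Fin 3 → Fin 4)) (g : Fin 4 → ℕ) (hmono : Monotone g)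
    (hshape : ∀ k, (r k).1 = 1 ∨ (∃ i j : Fin 3, i < j ∧ (r k).1 = Equiv.swap i j ∧ (r k).2 i = (r k).2 j) ∨ (∀ i, (r k).1 i ≠ i))
    (hM : ∀ a b : Fin (n + 1), a < b → ∀ l₁ l₂ : Fin 3,
      ((r a).1 l₁ = (r b).1 l₂ ∧ l₁ = l₂) ∨ ((r a).1 l₁ = l₂ ∧ (r b).1 l₂ = l₁) → (r a).2 l₁ ≤ (r b).2 l₂)
    (hR1 : ∀ a b : Fin (n + 1), a < b → (r a).1 = 1 → ∀ i j : Fin 3, i ≠ j → (r b).1 = Equiv.swap i j → (r b).2 i = (r b).2 j →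
      g ((r a).2 i) + g ((r a).2 j) < 2 * g ((r b).2 i))
    (hR1' : ∀ a b : Fin (n + 1), a < b → (r b).1 = 1 → ∀ i j : Fin 3, i ≠ j → (r a).1 = Equiv.swap i j → (r a).2 i = (r a).2 j →
      2 * g ((r a).2 i) < g ((r b).2 i) + g ((r b).2 j))
    (hR2 : ∀ a b : Fin (n + 1), a < b → ∀ i j k : Fin 3, i ≠ j → k ≠ i → k ≠ j → (r a).1 = Equiv.swap i j →
      (r a).2 i = (r a).2 j → (r b).1 i = j → (r b).1 j = k → (r b).1 k = i →
      g ((r a).2 k) + g ((r a).2 i) < g ((r b).2 j) + g ((r b).2 k))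
    (hR2' : ∀ a b : Fin (n + 1), a < b → ∀ i j k : Fin 3, i ≠ j → k ≠ i → k ≠ j → (r a).1 i = j → (r a).1 j = k → (r a).1 k = i →
      (r b).1 = Equiv.swap i j → (r b).2 i = (r b).2 j → g ((r a).2 j) + g ((r a).2 k) < g ((r b).2 k) + g ((r b).2 i))
    (hR3 : ∀ a b : Fin (n + 1), a < b → (r a).1 = 1 → ∀ i j k : Fin 3, i ≠ j → k ≠ i → k ≠ j →
      (r b).1 i = j → (r b).1 j = k → (r b).1 k = i → g ((r a).2 i) + g ((r a).2 j) < 2 * g ((r b).2 i))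
    (hR3' : ∀ a b : Fin (n + 1), a < b → (r b).1 = 1 → ∀ i j k : Fin 3, i ≠ j → k ≠ i → k ≠ j →
      (r a).1 i = j → (r a).1 j = k → (r a).1 k = i → 2 * g ((r a).2 i) < g ((r b).2 i) + g ((r b).2 j))
    (a b f e q : Fin (n + 1))
    (haC : TropicalCensus.classSym (r a) = TropicalCensus.classSym ((1 : Equiv.Perm (Fin 3)), (![0, 1, 3] : Fin 3 → Fin 4)))
    (hbC : TropicalCensus.classSym (r b) = TropicalCensus.classSym ((1 : Equiv.Perm (Fin 3)), (![0, 2, 3] : Fin 3 → Fin 4)))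
    (hfC : TropicalCensus.classSym (r f) = TropicalCensus.classSym ((1 : Equiv.Perm (Fin 3)), (![1, 1, 3] : Fin 3 → Fin 4)))
    (heC : TropicalCensus.classSym (r e) = TropicalCensus.classSym ((1 : Equiv.Perm (Fin 3)), (![1, 2, 2] : Fin 3 → Fin 4)))
    (hqC : TropicalCensus.classSym (r q) = TropicalCensus.classSym ((1 : Equiv.Perm (Fin 3)), (![2, 2, 2] : Fin 3 → Fin 4))) : False := by
  have ca : ∀ l, (univ.filter fun x => (r a).2 x = l).card = (![1, 1, 0, 1] : Fin 4 → ℕ) l :=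
    fun l => (card_filter_eq_of_classSym_eq haC l).trans (cnt013 l)
  have cb : ∀ l, (univ.filter fun x => (r b).2 x = l).card = (![1, 0, 1, 1] : Fin 4 → ℕ) l :=
    fun l => (card_filter_eq_of_classSym_eq hbC l).trans (cnt023 l)
  have ce : ∀ l, (univ.filter fun x => (r e).2 x = l).card = (![0, 1, 2, 0] : Fin 4 → ℕ) l :=
    fun l => (card_filter_eq_of_classSym_eq heC l).trans (cnt122 l)
  have cq : ∀ l, (univ.filter fun x => (r q).2 x = l).card = (![0, 0, 3, 0] : Fin 4 → ℕ) l :=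
    fun l => (card_filter_eq_of_classSym_eq hqC l).trans (cnt222 l)
  obtain ⟨a0, ha0⟩ := exists_of_card_pos ((r a).2) 0 (by rw [ca 0]; decide)
  obtain ⟨a3, ha3⟩ := exists_of_card_pos ((r a).2) 3 (by rw [ca 3]; decide)
  obtain ⟨b0, hb0⟩ := exists_of_card_pos ((r b).2) 0 (by rw [cb 0]; decide)
  obtain ⟨b3, hb3⟩ := exists_of_card_pos ((r b).2) 3 (by rw [cb 3]; decide)
  have e12 := letters12 r e (by rw [ce 0]; rfl) (by rw [ce 3]; rfl)
  have q12 := letters12 r q (by rw [cq 0]; rfl) (by rw [cq 3]; rfl)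
  have hbshape : (r b).1 = 1 ∨ ∀ i, (r b).1 i ≠ i := by
    rcases hshape b with h | h | h
    · exact Or.inl h
    · exact absurd h (not_swap_of_counts_le_one r b fun l => by rw [cb l]; fin_cases l <;> decide)
    · exact Or.inr h
  have hashape : (r a).1 = 1 ∨ ∀ i, (r a).1 i ≠ i := by
    rcases hshape a with h | h | h
    · exact Or.inl h
    · exact absurd h (not_swap_of_counts_le_one r a fun l => by rw [ca l]; fin_cases l <;> decide)
    · exact Or.inr h
  rcases hbshape with hb1 | hbC'
  · rcases hashape with ha1 | haC'
    · rcases hshape e with he1 | ⟨ie, je, hije, hes, hee⟩ | heC'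
      · exact DD_023_low r hM b e hb1 he1 hbC e12
      · rcases hshape q with hq1 | ⟨iq, jq, hijq, hqs, hqq⟩ | hqC'
        · exact DD_023_low r hM b q hb1 hq1 hbC q12
        · exact K11 r g hmono hM hR1 hR1' a b e q ha1 hb1 haC hbC heC hqC hije hes hee hijq hqs hqq
        · exact D023_C222 r g hmono hR3 hR3' b q hb1 hqC' hbC hqC
      · exact K2 r g hmono hM hR3 hR3' a b e ha1 hb1 heC' haC hbC heC
    · exact C_extreme_D r g hmono hR3 hR3' b a hb1 haC' a0 a3 ha0 ha3
  · rcases hshape f with hf1 | ⟨i, j, hij, hfs, hff⟩ | hfC'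
    · exact C_extreme_D r g hmono hR3 hR3' f b hf1 hbC' b0 b3 hb0 hb3
    · exact TC_023_113 r g hmono hM hR2 hR2' b f hbC' hbC hfC hij hfs hff
    · exact CC_023_113 r hM b f hbC' hfC' hbC hfC

end SymmetricOrbitThreeFour

end Summit.ValiantsHypothesis.ValiantsHypothesis.Theorems.KPlusLogSqLaw
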